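import Summits.HodgeConjecture.CorCM.MultiFieldWeilAtMostTwoPerFieldFamilies
import Summits.HodgeConjecture.CorCM.MultiFieldWeilTwoPerFieldFactors
import HarnessLib

/-!
# MULTI-FIELD WEIL ENGINE — ON THE VARIETY, AT MOST TWO CLASSES PER HAS-k FIELD: a complex abelian variety of CM type with simple isogeny factors of dimension `≤ 3` in which
# EVERY sextic CM field with an imaginary quadratic subfield may carry TWO isogeny classes of threefold factors — the Hodge conjecture for everything dominated by its powers,
# given ONLY Markman's fourfold theorem

Cell `pub-hodgecm2` (COR-CM), seat b30 gen 37 (2026-08-25); own lane MULTI-FIELD WEIL ENGINE (stem `MultiFieldWeil*`) — `CorCM/MultiFieldWeilAtMostTwoPerFieldFamilies.lean` (T6b)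
read on the variety through Milne's regrouping, in the pattern (text port) of `CorCM/MultiFieldWeilTwoPerFieldFactors.lean` (T7) whose clause (b₂′) «doubled fields do not share
an imaginary quadratic field» is WEAKENED here to (b₂″) «at most TWO classes per sextic field with an imaginary quadratic subfield» (the twin-pairs group block, T1b–T5b).
Theorems only; no definition, no named fact, no `sorry`.  HONEST FRAMING: conditional on the displayed Markman fourfold binder only; `HC_CM` is NOT proved and not asserted — a
statement about a NAMED CLASS of CM abelian varieties.

THE STATEMENT (**`hodgeConjectureFor_of_avDominatedBy_powSucc_of_isOfCMType_of_atMostTwoPerField_of_markman`**).  `X` of CM type; (a) simple isogeny factors of dimension `≤ 3`;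
(b₂″) AT MOST TWO CLASSES PER HAS-k FIELD: no three pairwise non-isogenous simple threefold factors `B₀, B₁, B₂` with `K₁ ≃ K₀ ≃ K₂` (all CM realisations) when `K₀` has a
totally complex quadratic subfield; (b₄) NO SISTER OF A DOUBLED FIELD: for `B₀ ≁ B₁` with `K₁ ≃ K₀` having a totally complex quadratic subfield and a third threefold factor `B₂`
with `K₂ ≄ K₀`, `L(K₂) ≠ L(K₀)`; (b₃) at most THREE classes per field; (c) no dihedral surface triple.  Then EVERY complex abelian variety dominated by a power `X^{N+1}` satisfies
the Hodge conjecture, GIVEN ONLY `Markman2025_weilClasses_algebraic_abelianFourfold`.  Example newly covered: `E_k × B × B^σ × C × C^{σ′} × T` with `B, B^σ` over `k·F⁺`, `C, C^{σ′}`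
over `k·F₂⁺`, `T` over `k·F₃⁺` (pairwise non-isomorphic cubics with pairwise different Galois closures of the sextics).  HONEST LIMITS: a doubled field with a sister `k′·F⁺`; three
classes of one `k·F⁺`; four classes of one field; the dihedral surface triple; simple factors of dimension `≥ 4`.
[cite: MoonenZarhin1999LowDim, Thm. (0.1), Thm. (0.2), §3 (3.1), Cor. (3.9), §5 (5.2)] [cite: Markman2025SurveySecant, Thm. 1.2] [cite: Milne1999LefschetzClasses, §1 Prop. 1.1]
[cite: MilneCM2006, Ch. I Prop. 3.13] [cite: Dodson1984, §5.1.2 Theorem] [cite: MumfordAV1970, §19 Thm. 1, Cor. 1–2 and p. 169] [cite: Lang2002, I §6 Thm. 6.4 (ii); VI §1 Thm. 1.1]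
-/

noncomputable section

open CategoryTheory CategoryTheory.Limits NumberField IntermediateField

namespace Summit.HodgeConjecture.CorCM.MultiFieldWeil

open Literature.AlgebraicGeometry Literature.AlgebraicGeometry.Motives Literature.AlgebraicGeometry.HodgeTheory
open Literature.AlgebraicGeometry.Motives.AbelianVariety
open Literature.AlgebraicGeometry.ComplexMultiplication (IsCMTypeRealisation exists_ringEquiv_forall_mem_iff_of_isIsogenous)
open Literature.AlgebraicTopology.SingularHomology
open Literature.NumberTheory.ComplexMultiplication
open Literature.AlgebraicGeometry.Milne1999 (IsOfCMType)
open Summit.HodgeConjecture.CorCM.Domination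

open scoped Classical

section OnTheVariety

variable {X : AbelianVariety ℂ}

/-- Powers of a zero-dimensional abelian variety are zero-dimensional. [folklore] -/
private theorem dim_powSucc_eq_zero₃₇w (h0 : X.dim = 0) : ∀ N : ℕ, (X.powSucc N).dim = 0
  | 0 => h0
  | N + 1 => by rw [powSucc_succ, dim_prod, dim_powSucc_eq_zero₃₇w h0 N, h0]

/-- **MAIN THEOREM (on the variety) — AT MOST TWO CLASSES PER HAS-k FIELD (ANY NUMBER OF DOUBLED FIELDS OVER k), THREE PER FIELD, NO DIHEDRAL SURFACE TRIPLE, ANY ELLIPTIC FACTORS —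
given ONLY Markman's fourfold theorem.**  See the module docstring: (a), (b₂″) `hT3`, (b₄) `hT4`, (b₃) `hT4'`, (c) `hS`.  `HC_CM` is NOT asserted. [cite: Milne1999LefschetzClasses, §1 Prop. 1.1]
[cite: MoonenZarhin1999LowDim, Thm. (0.1), (0.2), §3 (3.1), Cor. (3.9)] [cite: Markman2025SurveySecant, Thm. 1.2] [cite: Dodson1984, §5.1.2 Theorem] [cite: MumfordAV1970, §19 Thm. 1, Cor. 1–2] -/
theorem hodgeConjectureFor_of_avDominatedBy_powSucc_of_isOfCMType_of_atMostTwoPerField_of_markman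
    (hW4 : Markman2025_weilClasses_algebraic_abelianFourfold) (hcm : IsOfCMType X)
    (h3 : ∀ B : AbelianVariety ℂ, B.IsSimple → AVDominatedBy B X → B.dim ≤ 3)
    (hT3 : ∀ B₀ B₁ B₂ : AbelianVariety ℂ, B₀.IsSimple → B₁.IsSimple → B₂.IsSimple → AVDominatedBy B₀ X → AVDominatedBy B₁ X → AVDominatedBy B₂ X →
      B₀.dim = 3 → B₁.dim = 3 → B₂.dim = 3 → ¬ IsIsogenous B₀ B₁ → ¬ IsIsogenous B₀ B₂ → ¬ IsIsogenous B₁ B₂ →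
      ∀ (K₀ : Type) [Field K₀] [NumberField K₀] [IsCMField K₀] (Φ₀ : CMType K₀) (ι₀ : 𝓞 K₀ →+* End B₀) (θ₀ : K₀ →+* Module.End ℂ (complexBetti B₀.X 1))
        (K₁ : Type) [Field K₁] [NumberField K₁] [IsCMField K₁] (Φ₁ : CMType K₁) (ι₁ : 𝓞 K₁ →+* End B₁) (θ₁ : K₁ →+* Module.End ℂ (complexBetti B₁.X 1))
        (K₂ : Type) [Field K₂] [NumberField K₂] [IsCMField K₂] (Φ₂ : CMType K₂) (ι₂ : 𝓞 K₂ →+* End B₂) (θ₂ : K₂ →+* Module.End ℂ (complexBetti B₂.X 1)),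
        IsCMTypeRealisation Φ₀ B₀ ι₀ θ₀ → IsCMTypeRealisation Φ₁ B₁ ι₁ θ₁ → IsCMTypeRealisation Φ₂ B₂ ι₂ θ₂ →
          (∃ F : IntermediateField ℚ K₀, Module.finrank ℚ F = 2 ∧ IsTotallyComplex F) → ¬ (Nonempty (K₁ ≃+* K₀) ∧ Nonempty (K₂ ≃+* K₀)))
    (hT4 : ∀ B₀ B₁ B₂ : AbelianVariety ℂ, B₀.IsSimple → B₁.IsSimple → B₂.IsSimple → AVDominatedBy B₀ X → AVDominatedBy B₁ X → AVDominatedBy B₂ X →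
      B₀.dim = 3 → B₁.dim = 3 → B₂.dim = 3 → ¬ IsIsogenous B₀ B₁ → ¬ IsIsogenous B₂ B₀ → ¬ IsIsogenous B₂ B₁ →
      ∀ (K₀ : Type) [Field K₀] [NumberField K₀] [IsCMField K₀] (Φ₀ : CMType K₀) (ι₀ : 𝓞 K₀ →+* End B₀) (θ₀ : K₀ →+* Module.End ℂ (complexBetti B₀.X 1))
        (K₁ : Type) [Field K₁] [NumberField K₁] [IsCMField K₁] (Φ₁ : CMType K₁) (ι₁ : 𝓞 K₁ →+* End B₁) (θ₁ : K₁ →+* Module.End ℂ (complexBetti B₁.X 1))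
        (K₂ : Type) [Field K₂] [NumberField K₂] [IsCMField K₂] (Φ₂ : CMType K₂) (ι₂ : 𝓞 K₂ →+* End B₂) (θ₂ : K₂ →+* Module.End ℂ (complexBetti B₂.X 1)),
        IsCMTypeRealisation Φ₀ B₀ ι₀ θ₀ → IsCMTypeRealisation Φ₁ B₁ ι₁ θ₁ → IsCMTypeRealisation Φ₂ B₂ ι₂ θ₂ →
          (∃ F : IntermediateField ℚ K₀, Module.finrank ℚ F = 2 ∧ IsTotallyComplex F) → Nonempty (K₁ ≃+* K₀) → IsEmpty (K₂ ≃+* K₀) → normalClosure ℚ K₂ ℂ ≠ normalClosure ℚ K₀ ℂ)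
    (hT4' : ∀ B₀ B₁ B₂ B₃ : AbelianVariety ℂ, B₀.IsSimple → B₁.IsSimple → B₂.IsSimple → B₃.IsSimple →
      AVDominatedBy B₀ X → AVDominatedBy B₁ X → AVDominatedBy B₂ X → AVDominatedBy B₃ X → B₀.dim = 3 → B₁.dim = 3 → B₂.dim = 3 → B₃.dim = 3 →
      ¬ IsIsogenous B₀ B₁ → ¬ IsIsogenous B₀ B₂ → ¬ IsIsogenous B₀ B₃ → ¬ IsIsogenous B₁ B₂ → ¬ IsIsogenous B₁ B₃ → ¬ IsIsogenous B₂ B₃ →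
      ∀ (K₀ : Type) [Field K₀] [NumberField K₀] [IsCMField K₀] (Φ₀ : CMType K₀) (ι₀ : 𝓞 K₀ →+* End B₀) (θ₀ : K₀ →+* Module.End ℂ (complexBetti B₀.X 1))
        (K₁ : Type) [Field K₁] [NumberField K₁] [IsCMField K₁] (Φ₁ : CMType K₁) (ι₁ : 𝓞 K₁ →+* End B₁) (θ₁ : K₁ →+* Module.End ℂ (complexBetti B₁.X 1))
        (K₂ : Type) [Field K₂] [NumberField K₂] [IsCMField K₂] (Φ₂ : CMType K₂) (ι₂ : 𝓞 K₂ →+* End B₂) (θ₂ : K₂ →+* Module.End ℂ (complexBetti B₂.X 1))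
        (K₃ : Type) [Field K₃] [NumberField K₃] [IsCMField K₃] (Φ₃ : CMType K₃) (ι₃ : 𝓞 K₃ →+* End B₃) (θ₃ : K₃ →+* Module.End ℂ (complexBetti B₃.X 1)),
        IsCMTypeRealisation Φ₀ B₀ ι₀ θ₀ → IsCMTypeRealisation Φ₁ B₁ ι₁ θ₁ → IsCMTypeRealisation Φ₂ B₂ ι₂ θ₂ → IsCMTypeRealisation Φ₃ B₃ ι₃ θ₃ →
          ¬ (Nonempty (K₁ ≃+* K₀) ∧ Nonempty (K₂ ≃+* K₀) ∧ Nonempty (K₃ ≃+* K₀)))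
    (hS : ∀ B₀ B₁ B₂ : AbelianVariety ℂ, B₀.IsSimple → B₁.IsSimple → B₂.IsSimple → AVDominatedBy B₀ X → AVDominatedBy B₁ X → AVDominatedBy B₂ X →
      B₀.dim = 2 → B₁.dim = 2 → B₂.dim = 2 → ¬ IsIsogenous B₀ B₁ → ¬ IsIsogenous B₀ B₂ → ¬ IsIsogenous B₁ B₂ →
      ∀ (K₀ : Type) [Field K₀] [NumberField K₀] [IsCMField K₀] (Φ₀ : CMType K₀) (ι₀ : 𝓞 K₀ →+* End B₀) (θ₀ : K₀ →+* Module.End ℂ (complexBetti B₀.X 1))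
        (K₁ : Type) [Field K₁] [NumberField K₁] [IsCMField K₁] (Φ₁ : CMType K₁) (ι₁ : 𝓞 K₁ →+* End B₁) (θ₁ : K₁ →+* Module.End ℂ (complexBetti B₁.X 1))
        (K₂ : Type) [Field K₂] [NumberField K₂] [IsCMField K₂] (Φ₂ : CMType K₂) (ι₂ : 𝓞 K₂ →+* End B₂) (θ₂ : K₂ →+* Module.End ℂ (complexBetti B₂.X 1)),
        IsCMTypeRealisation Φ₀ B₀ ι₀ θ₀ → IsCMTypeRealisation Φ₁ B₁ ι₁ θ₁ → IsCMTypeRealisation Φ₂ B₂ ι₂ θ₂ →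
          ¬ (normalClosure ℚ K₀ ℂ = normalClosure ℚ K₁ ℂ ∧ normalClosure ℚ K₁ ℂ = normalClosure ℚ K₂ ℂ))
    {B : AbelianVariety ℂ} {N : ℕ} (hB : AVDominatedBy B (X.powSucc N)) : HodgeConjectureFor B.dim B.X := by
  rcases Nat.eq_zero_or_pos X.dim with h0 | hX0
  · exact hodgeConjectureFor_of_isDivisorGenerated _ (isDivisorGenerated_of_avDominatedBy hB
      (Literature.AlgebraicGeometry.Pohlmann1968.isDivisorGenerated_of_dim_eq_zero _ (dim_powSucc_eq_zero₃₇w h0 N)))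
  -- Milne's regrouping: `X ∼ ⨁_i A'_{cls i}`, `A'_c` simple, pairwise non-isogenous, CM-realised
  obtain ⟨C, _, K', _, _, _, Φ', A', ι', θ', m, cls, f, hA, hs, hniso, hcls, hf⟩ := exists_isIsogeny_biproduct_of_isSimple_of_isOfCMType (X := X) hX0 hcm
  have hXP : AVDominatedBy X (⨁ fun i => A' (cls i)) := AVDominatedBy.of_isIsogeny_hom hf (AVDominatedBy.refl _)
  have hPX : AVDominatedBy (⨁ fun i => A' (cls i)) X := AVDominatedBy.of_isIsogeny_inv hf (AVDominatedBy.refl _)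
  have hslot : ∀ c, AVDominatedBy (A' c) X := fun c => by
    obtain ⟨i, rfl⟩ := hcls c
    exact (avDominatedBy_biproduct_summand (fun i => A' (cls i)) i).trans hPX
  have hdim3 : ∀ c, (A' c).dim ≤ 3 := fun c => h3 _ (hs c) (hslot c)
  have hfin : ∀ c, Module.finrank ℚ (K' c) = 2 * (A' c).dim := fun c =>
    Literature.AlgebraicGeometry.Pohlmann1968.finrank_eq_two_mul_dim_of_isCMTypeRealisation (hA c)
  -- (b₂″)/(b₄) on the sextic slots
  have hQ2 : ∀ t : C, Module.finrank ℚ (K' t) = 6 → (∃ F : IntermediateField ℚ (K' t), Module.finrank ℚ F = 2 ∧ IsTotallyComplex F) →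
      (Finset.univ.filter fun t' => Nonempty (K' t' ≃+* K' t)).card ≤ 2 := by
    intro t ht hF
    by_contra hlt
    push Not at hlt
    obtain ⟨d, hd, hdm⟩ := exists_injective_fin_of_le_card (s := Finset.univ.filter fun t' => Nonempty (K' t' ≃+* K' t)) (n := 3) hlt
    have hiso : ∀ x, Nonempty (K' (d x) ≃+* K' t) := fun x => (Finset.mem_filter.1 (hdm x)).2
    have h6d : ∀ x, Module.finrank ℚ (K' (d x)) = 6 := fun x => by
      obtain ⟨e⟩ := hiso x
      rw [← ht]; exact (AlgEquiv.ofRingEquiv (f := e) fun q => map_ratCast e q).toLinearEquiv.finrank_eq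
    have hne : ∀ x y : Fin 3, x ≠ y → d x ≠ d y := fun x y h h' => h (hd h')
    have hcomp : ∀ x, Nonempty (K' (d x) ≃+* K' (d 0)) := fun x => by
      obtain ⟨e⟩ := hiso x; obtain ⟨e₀⟩ := hiso 0; exact ⟨e.trans e₀.symm⟩
    have hF' : ∃ F' : IntermediateField ℚ (K' (d 0)), Module.finrank ℚ F' = 2 ∧ IsTotallyComplex F' := by
      obtain ⟨F, hF2, hFtc⟩ := hF
      obtain ⟨e₀⟩ := hiso 0
      haveI : IsTotallyComplex F := hFtc
      obtain ⟨F', hF'2, hF'tc, -⟩ := exists_quadratic_subfield_of_ringHom_ringHom hF2 (e₀.symm.toRingHom.comp (algebraMap F (K' t))) (e₀.symm.toRingHom.comp (algebraMap F (K' t)))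
      exact ⟨F', hF'2, hF'tc⟩
    exact hT3 (A' (d 0)) (A' (d 1)) (A' (d 2)) (hs _) (hs _) (hs _) (hslot _) (hslot _) (hslot _)
      (by have := hfin (d 0); have := h6d 0; omega) (by have := hfin (d 1); have := h6d 1; omega) (by have := hfin (d 2); have := h6d 2; omega)
      (hniso _ _ (hne 0 1 (by decide))) (hniso _ _ (hne 0 2 (by decide))) (hniso _ _ (hne 1 2 (by decide)))
      (K' (d 0)) (Φ' (d 0)) (ι' (d 0)) (θ' (d 0)) (K' (d 1)) (Φ' (d 1)) (ι' (d 1)) (θ' (d 1)) (K' (d 2)) (Φ' (d 2)) (ι' (d 2)) (θ' (d 2))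
      (hA _) (hA _) (hA _) hF' ⟨hcomp 1, hcomp 2⟩
  have hQ4 : ∀ t t' t'' : C, t ≠ t' → t'' ≠ t → t'' ≠ t' → Module.finrank ℚ (K' t) = 6 → Module.finrank ℚ (K' t') = 6 → Module.finrank ℚ (K' t'') = 6 →
      (∃ F : IntermediateField ℚ (K' t), Module.finrank ℚ F = 2 ∧ IsTotallyComplex F) → Nonempty (K' t' ≃+* K' t) → IsEmpty (K' t'' ≃+* K' t) →
        normalClosure ℚ (K' t'') ℂ ≠ normalClosure ℚ (K' t) ℂ := fun t t' t'' htt h₁ h₂ ht ht' ht'' hF hi he =>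
    hT4 (A' t) (A' t') (A' t'') (hs t) (hs t') (hs t'') (hslot t) (hslot t') (hslot t'') (by have := hfin t; omega) (by have := hfin t'; omega)
      (by have := hfin t''; omega) (hniso t t' htt) (hniso t'' t h₁) (hniso t'' t' h₂)
      (K' t) (Φ' t) (ι' t) (θ' t) (K' t') (Φ' t') (ι' t') (θ' t') (K' t'') (Φ' t'') (ι' t'') (θ' t'') (hA t) (hA t') (hA t'') hF hi he
  -- pairwise non-isogeny of the slots, and (b″) at most three per isomorphism class
  have hN : ∀ t t' : C, t ≠ t' → Module.finrank ℚ (K' t) = 6 → Module.finrank ℚ (K' t') = 6 → ¬ IsIsogenous (A' t) (A' t') := fun t t' h _ _ => hniso t t' h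
  have hB3 : ∀ t : C, Module.finrank ℚ (K' t) = 6 → (Finset.univ.filter fun t' => Nonempty (K' t' ≃+* K' t)).card ≤ 3 := by
    intro t ht
    by_contra hlt
    push Not at hlt
    obtain ⟨d, hd, hdm⟩ := exists_injective_fin_of_le_card (s := Finset.univ.filter fun t' => Nonempty (K' t' ≃+* K' t)) (n := 4) hlt
    have hiso : ∀ x, Nonempty (K' (d x) ≃+* K' t) := fun x => (Finset.mem_filter.1 (hdm x)).2
    have h6d : ∀ x, Module.finrank ℚ (K' (d x)) = 6 := fun x => by
      obtain ⟨e⟩ := hiso x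
      rw [← ht]; exact (AlgEquiv.ofRingEquiv (f := e) fun q => map_ratCast e q).toLinearEquiv.finrank_eq
    have hne : ∀ x y : Fin 4, x ≠ y → d x ≠ d y := fun x y h h' => h (hd h')
    have hcomp : ∀ x, Nonempty (K' (d x) ≃+* K' (d 0)) := fun x => by
      obtain ⟨e⟩ := hiso x; obtain ⟨e₀⟩ := hiso 0; exact ⟨e.trans e₀.symm⟩
    exact hT4' (A' (d 0)) (A' (d 1)) (A' (d 2)) (A' (d 3)) (hs _) (hs _) (hs _) (hs _) (hslot _) (hslot _) (hslot _) (hslot _)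
      (by have := hfin (d 0); have := h6d 0; omega) (by have := hfin (d 1); have := h6d 1; omega) (by have := hfin (d 2); have := h6d 2; omega)
      (by have := hfin (d 3); have := h6d 3; omega)
      (hniso _ _ (hne 0 1 (by decide))) (hniso _ _ (hne 0 2 (by decide))) (hniso _ _ (hne 0 3 (by decide))) (hniso _ _ (hne 1 2 (by decide)))
      (hniso _ _ (hne 1 3 (by decide))) (hniso _ _ (hne 2 3 (by decide)))
      (K' (d 0)) (Φ' (d 0)) (ι' (d 0)) (θ' (d 0)) (K' (d 1)) (Φ' (d 1)) (ι' (d 1)) (θ' (d 1)) (K' (d 2)) (Φ' (d 2)) (ι' (d 2)) (θ' (d 2)) (K' (d 3)) (Φ' (d 3)) (ι' (d 3)) (θ' (d 3))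
      (hA _) (hA _) (hA _) (hA _) ⟨hcomp 1, hcomp 2, hcomp 3⟩
  -- (c) on the quartic slots
  have hS3 : ∀ i j l : C, Module.finrank ℚ (K' i) = 4 → Module.finrank ℚ (K' j) = 4 → Module.finrank ℚ (K' l) = 4 →
      normalClosure ℚ (K' i) ℂ = normalClosure ℚ (K' j) ℂ → normalClosure ℚ (K' j) ℂ = normalClosure ℚ (K' l) ℂ →
      IsIsogenous (A' i) (A' j) ∨ IsIsogenous (A' i) (A' l) ∨ IsIsogenous (A' j) (A' l) := by
    intro i j l hi hj hl hLij hLjl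
    by_cases hij : i = j
    · subst hij
      exact Or.inl (IsIsogenous.refl _)
    by_cases hil : i = l
    · subst hil
      exact Or.inr (Or.inl (IsIsogenous.refl _))
    by_cases hjl : j = l
    · subst hjl
      exact Or.inr (Or.inr (IsIsogenous.refl _))
    exact absurd ⟨hLij, hLjl⟩ (hS (A' i) (A' j) (A' l) (hs i) (hs j) (hs l) (hslot i) (hslot j) (hslot l) (by have := hfin i; omega)
      (by have := hfin j; omega) (by have := hfin l; omega) (hniso i j hij) (hniso i l hil) (hniso j l hjl)
      (K' i) (Φ' i) (ι' i) (θ' i) (K' j) (Φ' j) (ι' j) (θ' j) (K' l) (Φ' l) (ι' l) (θ' l) (hA i) (hA j) (hA l))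
  -- every power of `X` is dominated by a product of copies of the slots
  obtain ⟨n, π, hdom⟩ := exists_avDominatedBy_powSucc_biproduct_slots A' cls hXP N
  exact Domination.hodgeConjectureFor_of_avDominatedBy (hodgeConjectureFor_prod_of_atMostTwoPerField_of_markman (I := C) hW4 hA hs hdim3 hQ2 hQ4 hN hB3 hS3 π) (hB.trans hdom)

/-- **The Hodge conjecture for `X` itself and all its powers**, under (a), (b₂″), (b₄), (b₃), (c), given only Markman's fourfold theorem. [cite: MoonenZarhin1999LowDim, Thm. (0.1), (0.2)]
[cite: Markman2025SurveySecant, Thm. 1.2] -/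
theorem hodgeConjectureFor_powSucc_of_isOfCMType_of_atMostTwoPerField_of_markman (hW4 : Markman2025_weilClasses_algebraic_abelianFourfold)
    (hcm : IsOfCMType X) (h3 : ∀ B : AbelianVariety ℂ, B.IsSimple → AVDominatedBy B X → B.dim ≤ 3)
    (hT3 : ∀ B₀ B₁ B₂ : AbelianVariety ℂ, B₀.IsSimple → B₁.IsSimple → B₂.IsSimple → AVDominatedBy B₀ X → AVDominatedBy B₁ X → AVDominatedBy B₂ X →
      B₀.dim = 3 → B₁.dim = 3 → B₂.dim = 3 → ¬ IsIsogenous B₀ B₁ → ¬ IsIsogenous B₀ B₂ → ¬ IsIsogenous B₁ B₂ →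
      ∀ (K₀ : Type) [Field K₀] [NumberField K₀] [IsCMField K₀] (Φ₀ : CMType K₀) (ι₀ : 𝓞 K₀ →+* End B₀) (θ₀ : K₀ →+* Module.End ℂ (complexBetti B₀.X 1))
        (K₁ : Type) [Field K₁] [NumberField K₁] [IsCMField K₁] (Φ₁ : CMType K₁) (ι₁ : 𝓞 K₁ →+* End B₁) (θ₁ : K₁ →+* Module.End ℂ (complexBetti B₁.X 1))
        (K₂ : Type) [Field K₂] [NumberField K₂] [IsCMField K₂] (Φ₂ : CMType K₂) (ι₂ : 𝓞 K₂ →+* End B₂) (θ₂ : K₂ →+* Module.End ℂ (complexBetti B₂.X 1)),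
        IsCMTypeRealisation Φ₀ B₀ ι₀ θ₀ → IsCMTypeRealisation Φ₁ B₁ ι₁ θ₁ → IsCMTypeRealisation Φ₂ B₂ ι₂ θ₂ →
          (∃ F : IntermediateField ℚ K₀, Module.finrank ℚ F = 2 ∧ IsTotallyComplex F) → ¬ (Nonempty (K₁ ≃+* K₀) ∧ Nonempty (K₂ ≃+* K₀)))
    (hT4 : ∀ B₀ B₁ B₂ : AbelianVariety ℂ, B₀.IsSimple → B₁.IsSimple → B₂.IsSimple → AVDominatedBy B₀ X → AVDominatedBy B₁ X → AVDominatedBy B₂ X →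
      B₀.dim = 3 → B₁.dim = 3 → B₂.dim = 3 → ¬ IsIsogenous B₀ B₁ → ¬ IsIsogenous B₂ B₀ → ¬ IsIsogenous B₂ B₁ →
      ∀ (K₀ : Type) [Field K₀] [NumberField K₀] [IsCMField K₀] (Φ₀ : CMType K₀) (ι₀ : 𝓞 K₀ →+* End B₀) (θ₀ : K₀ →+* Module.End ℂ (complexBetti B₀.X 1))
        (K₁ : Type) [Field K₁] [NumberField K₁] [IsCMField K₁] (Φ₁ : CMType K₁) (ι₁ : 𝓞 K₁ →+* End B₁) (θ₁ : K₁ →+* Module.End ℂ (complexBetti B₁.X 1))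
        (K₂ : Type) [Field K₂] [NumberField K₂] [IsCMField K₂] (Φ₂ : CMType K₂) (ι₂ : 𝓞 K₂ →+* End B₂) (θ₂ : K₂ →+* Module.End ℂ (complexBetti B₂.X 1)),
        IsCMTypeRealisation Φ₀ B₀ ι₀ θ₀ → IsCMTypeRealisation Φ₁ B₁ ι₁ θ₁ → IsCMTypeRealisation Φ₂ B₂ ι₂ θ₂ →
          (∃ F : IntermediateField ℚ K₀, Module.finrank ℚ F = 2 ∧ IsTotallyComplex F) → Nonempty (K₁ ≃+* K₀) → IsEmpty (K₂ ≃+* K₀) → normalClosure ℚ K₂ ℂ ≠ normalClosure ℚ K₀ ℂ)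
    (hT4' : ∀ B₀ B₁ B₂ B₃ : AbelianVariety ℂ, B₀.IsSimple → B₁.IsSimple → B₂.IsSimple → B₃.IsSimple →
      AVDominatedBy B₀ X → AVDominatedBy B₁ X → AVDominatedBy B₂ X → AVDominatedBy B₃ X → B₀.dim = 3 → B₁.dim = 3 → B₂.dim = 3 → B₃.dim = 3 →
      ¬ IsIsogenous B₀ B₁ → ¬ IsIsogenous B₀ B₂ → ¬ IsIsogenous B₀ B₃ → ¬ IsIsogenous B₁ B₂ → ¬ IsIsogenous B₁ B₃ → ¬ IsIsogenous B₂ B₃ →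
      ∀ (K₀ : Type) [Field K₀] [NumberField K₀] [IsCMField K₀] (Φ₀ : CMType K₀) (ι₀ : 𝓞 K₀ →+* End B₀) (θ₀ : K₀ →+* Module.End ℂ (complexBetti B₀.X 1))
        (K₁ : Type) [Field K₁] [NumberField K₁] [IsCMField K₁] (Φ₁ : CMType K₁) (ι₁ : 𝓞 K₁ →+* End B₁) (θ₁ : K₁ →+* Module.End ℂ (complexBetti B₁.X 1))
        (K₂ : Type) [Field K₂] [NumberField K₂] [IsCMField K₂] (Φ₂ : CMType K₂) (ι₂ : 𝓞 K₂ →+* End B₂) (θ₂ : K₂ →+* Module.End ℂ (complexBetti B₂.X 1))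
        (K₃ : Type) [Field K₃] [NumberField K₃] [IsCMField K₃] (Φ₃ : CMType K₃) (ι₃ : 𝓞 K₃ →+* End B₃) (θ₃ : K₃ →+* Module.End ℂ (complexBetti B₃.X 1)),
        IsCMTypeRealisation Φ₀ B₀ ι₀ θ₀ → IsCMTypeRealisation Φ₁ B₁ ι₁ θ₁ → IsCMTypeRealisation Φ₂ B₂ ι₂ θ₂ → IsCMTypeRealisation Φ₃ B₃ ι₃ θ₃ →
          ¬ (Nonempty (K₁ ≃+* K₀) ∧ Nonempty (K₂ ≃+* K₀) ∧ Nonempty (K₃ ≃+* K₀)))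
    (hS : ∀ B₀ B₁ B₂ : AbelianVariety ℂ, B₀.IsSimple → B₁.IsSimple → B₂.IsSimple → AVDominatedBy B₀ X → AVDominatedBy B₁ X → AVDominatedBy B₂ X →
      B₀.dim = 2 → B₁.dim = 2 → B₂.dim = 2 → ¬ IsIsogenous B₀ B₁ → ¬ IsIsogenous B₀ B₂ → ¬ IsIsogenous B₁ B₂ →
      ∀ (K₀ : Type) [Field K₀] [NumberField K₀] [IsCMField K₀] (Φ₀ : CMType K₀) (ι₀ : 𝓞 K₀ →+* End B₀) (θ₀ : K₀ →+* Module.End ℂ (complexBetti B₀.X 1))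
        (K₁ : Type) [Field K₁] [NumberField K₁] [IsCMField K₁] (Φ₁ : CMType K₁) (ι₁ : 𝓞 K₁ →+* End B₁) (θ₁ : K₁ →+* Module.End ℂ (complexBetti B₁.X 1))
        (K₂ : Type) [Field K₂] [NumberField K₂] [IsCMField K₂] (Φ₂ : CMType K₂) (ι₂ : 𝓞 K₂ →+* End B₂) (θ₂ : K₂ →+* Module.End ℂ (complexBetti B₂.X 1)),
        IsCMTypeRealisation Φ₀ B₀ ι₀ θ₀ → IsCMTypeRealisation Φ₁ B₁ ι₁ θ₁ → IsCMTypeRealisation Φ₂ B₂ ι₂ θ₂ →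
          ¬ (normalClosure ℚ K₀ ℂ = normalClosure ℚ K₁ ℂ ∧ normalClosure ℚ K₁ ℂ = normalClosure ℚ K₂ ℂ))
    (N : ℕ) : HodgeConjectureFor (X.powSucc N).dim (X.powSucc N).X :=
  hodgeConjectureFor_of_avDominatedBy_powSucc_of_isOfCMType_of_atMostTwoPerField_of_markman hW4 hcm h3 hT3 hT4 hT4' hS (AVDominatedBy.refl _)

/-! ## §2 The witnessed form of (b₂″), (b₄): checked on one tuple of CM realisations -/

/-- **(b₂″), (b₄) WITNESSED.**  As the main theorem, with (b₂″) and (b₄) asked for ONE tuple of CM realisations of the factors concerned: the CM field of a simple CM abelian variety is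
unique up to isomorphism, and quadratic subfields, (non-)isomorphy and Galois closures transport along field isomorphisms. [cite: MilneCM2006, Ch. I Prop. 3.13]
[cite: Milne1999LefschetzClasses, §1 Prop. 1.1] [cite: MoonenZarhin1999LowDim, Thm. (0.1), (0.2), §3 (3.1), Cor. (3.9)] [cite: Markman2025SurveySecant, Thm. 1.2] [cite: Lang2002, VI §1 Thm. 1.1 and Cor. 1.6] -/
theorem hodgeConjectureFor_of_avDominatedBy_powSucc_of_isOfCMType_of_witnessed_atMostTwoPerField_of_markman
    (hW4 : Markman2025_weilClasses_algebraic_abelianFourfold) (hcm : IsOfCMType X)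
    (h3 : ∀ B : AbelianVariety ℂ, B.IsSimple → AVDominatedBy B X → B.dim ≤ 3)
    (hT3 : ∀ B₀ B₁ B₂ : AbelianVariety ℂ, B₀.IsSimple → B₁.IsSimple → B₂.IsSimple → AVDominatedBy B₀ X → AVDominatedBy B₁ X → AVDominatedBy B₂ X →
      B₀.dim = 3 → B₁.dim = 3 → B₂.dim = 3 → ¬ IsIsogenous B₀ B₁ → ¬ IsIsogenous B₀ B₂ → ¬ IsIsogenous B₁ B₂ →
      ∃ (K₀ : Type) (_ : Field K₀) (_ : NumberField K₀) (_ : IsCMField K₀) (Φ₀ : CMType K₀) (ι₀ : 𝓞 K₀ →+* End B₀) (θ₀ : K₀ →+* Module.End ℂ (complexBetti B₀.X 1))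
        (K₁ : Type) (_ : Field K₁) (_ : NumberField K₁) (_ : IsCMField K₁) (Φ₁ : CMType K₁) (ι₁ : 𝓞 K₁ →+* End B₁) (θ₁ : K₁ →+* Module.End ℂ (complexBetti B₁.X 1))
        (K₂ : Type) (_ : Field K₂) (_ : NumberField K₂) (_ : IsCMField K₂) (Φ₂ : CMType K₂) (ι₂ : 𝓞 K₂ →+* End B₂) (θ₂ : K₂ →+* Module.End ℂ (complexBetti B₂.X 1)),
        IsCMTypeRealisation Φ₀ B₀ ι₀ θ₀ ∧ IsCMTypeRealisation Φ₁ B₁ ι₁ θ₁ ∧ IsCMTypeRealisation Φ₂ B₂ ι₂ θ₂ ∧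
          ((∃ F : IntermediateField ℚ K₀, Module.finrank ℚ F = 2 ∧ IsTotallyComplex F) → ¬ (Nonempty (K₁ ≃+* K₀) ∧ Nonempty (K₂ ≃+* K₀))))
    (hT4 : ∀ B₀ B₁ B₂ : AbelianVariety ℂ, B₀.IsSimple → B₁.IsSimple → B₂.IsSimple → AVDominatedBy B₀ X → AVDominatedBy B₁ X → AVDominatedBy B₂ X →
      B₀.dim = 3 → B₁.dim = 3 → B₂.dim = 3 → ¬ IsIsogenous B₀ B₁ → ¬ IsIsogenous B₂ B₀ → ¬ IsIsogenous B₂ B₁ →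
      ∃ (K₀ : Type) (_ : Field K₀) (_ : NumberField K₀) (_ : IsCMField K₀) (Φ₀ : CMType K₀) (ι₀ : 𝓞 K₀ →+* End B₀) (θ₀ : K₀ →+* Module.End ℂ (complexBetti B₀.X 1))
        (K₁ : Type) (_ : Field K₁) (_ : NumberField K₁) (_ : IsCMField K₁) (Φ₁ : CMType K₁) (ι₁ : 𝓞 K₁ →+* End B₁) (θ₁ : K₁ →+* Module.End ℂ (complexBetti B₁.X 1))
        (K₂ : Type) (_ : Field K₂) (_ : NumberField K₂) (_ : IsCMField K₂) (Φ₂ : CMType K₂) (ι₂ : 𝓞 K₂ →+* End B₂) (θ₂ : K₂ →+* Module.End ℂ (complexBetti B₂.X 1)),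
        IsCMTypeRealisation Φ₀ B₀ ι₀ θ₀ ∧ IsCMTypeRealisation Φ₁ B₁ ι₁ θ₁ ∧ IsCMTypeRealisation Φ₂ B₂ ι₂ θ₂ ∧
          ((∃ F : IntermediateField ℚ K₀, Module.finrank ℚ F = 2 ∧ IsTotallyComplex F) → Nonempty (K₁ ≃+* K₀) → IsEmpty (K₂ ≃+* K₀) → normalClosure ℚ K₂ ℂ ≠ normalClosure ℚ K₀ ℂ))
    (hT4' : ∀ B₀ B₁ B₂ B₃ : AbelianVariety ℂ, B₀.IsSimple → B₁.IsSimple → B₂.IsSimple → B₃.IsSimple →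
      AVDominatedBy B₀ X → AVDominatedBy B₁ X → AVDominatedBy B₂ X → AVDominatedBy B₃ X → B₀.dim = 3 → B₁.dim = 3 → B₂.dim = 3 → B₃.dim = 3 →
      ¬ IsIsogenous B₀ B₁ → ¬ IsIsogenous B₀ B₂ → ¬ IsIsogenous B₀ B₃ → ¬ IsIsogenous B₁ B₂ → ¬ IsIsogenous B₁ B₃ → ¬ IsIsogenous B₂ B₃ →
      ∀ (K₀ : Type) [Field K₀] [NumberField K₀] [IsCMField K₀] (Φ₀ : CMType K₀) (ι₀ : 𝓞 K₀ →+* End B₀) (θ₀ : K₀ →+* Module.End ℂ (complexBetti B₀.X 1))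
        (K₁ : Type) [Field K₁] [NumberField K₁] [IsCMField K₁] (Φ₁ : CMType K₁) (ι₁ : 𝓞 K₁ →+* End B₁) (θ₁ : K₁ →+* Module.End ℂ (complexBetti B₁.X 1))
        (K₂ : Type) [Field K₂] [NumberField K₂] [IsCMField K₂] (Φ₂ : CMType K₂) (ι₂ : 𝓞 K₂ →+* End B₂) (θ₂ : K₂ →+* Module.End ℂ (complexBetti B₂.X 1))
        (K₃ : Type) [Field K₃] [NumberField K₃] [IsCMField K₃] (Φ₃ : CMType K₃) (ι₃ : 𝓞 K₃ →+* End B₃) (θ₃ : K₃ →+* Module.End ℂ (complexBetti B₃.X 1)),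
        IsCMTypeRealisation Φ₀ B₀ ι₀ θ₀ → IsCMTypeRealisation Φ₁ B₁ ι₁ θ₁ → IsCMTypeRealisation Φ₂ B₂ ι₂ θ₂ → IsCMTypeRealisation Φ₃ B₃ ι₃ θ₃ →
          ¬ (Nonempty (K₁ ≃+* K₀) ∧ Nonempty (K₂ ≃+* K₀) ∧ Nonempty (K₃ ≃+* K₀)))
    (hS : ∀ B₀ B₁ B₂ : AbelianVariety ℂ, B₀.IsSimple → B₁.IsSimple → B₂.IsSimple → AVDominatedBy B₀ X → AVDominatedBy B₁ X → AVDominatedBy B₂ X →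
      B₀.dim = 2 → B₁.dim = 2 → B₂.dim = 2 → ¬ IsIsogenous B₀ B₁ → ¬ IsIsogenous B₀ B₂ → ¬ IsIsogenous B₁ B₂ →
      ∀ (K₀ : Type) [Field K₀] [NumberField K₀] [IsCMField K₀] (Φ₀ : CMType K₀) (ι₀ : 𝓞 K₀ →+* End B₀) (θ₀ : K₀ →+* Module.End ℂ (complexBetti B₀.X 1))
        (K₁ : Type) [Field K₁] [NumberField K₁] [IsCMField K₁] (Φ₁ : CMType K₁) (ι₁ : 𝓞 K₁ →+* End B₁) (θ₁ : K₁ →+* Module.End ℂ (complexBetti B₁.X 1))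
        (K₂ : Type) [Field K₂] [NumberField K₂] [IsCMField K₂] (Φ₂ : CMType K₂) (ι₂ : 𝓞 K₂ →+* End B₂) (θ₂ : K₂ →+* Module.End ℂ (complexBetti B₂.X 1)),
        IsCMTypeRealisation Φ₀ B₀ ι₀ θ₀ → IsCMTypeRealisation Φ₁ B₁ ι₁ θ₁ → IsCMTypeRealisation Φ₂ B₂ ι₂ θ₂ →
          ¬ (normalClosure ℚ K₀ ℂ = normalClosure ℚ K₁ ℂ ∧ normalClosure ℚ K₁ ℂ = normalClosure ℚ K₂ ℂ))
    {B : AbelianVariety ℂ} {N : ℕ} (hB : AVDominatedBy B (X.powSucc N)) : HodgeConjectureFor B.dim B.X := by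
  refine hodgeConjectureFor_of_avDominatedBy_powSucc_of_isOfCMType_of_atMostTwoPerField_of_markman hW4 hcm h3 ?_ ?_ hT4' hS hB
  · intro B₀ B₁ B₂ hs₀ hs₁ hs₂ hd₀ hd₁ hd₂ h3₀ h3₁ h3₂ hn₀₁ hn₀₂ hn₁₂ K₀ _ _ _ Φ₀ ι₀ θ₀ K₁ _ _ _ Φ₁ ι₁ θ₁ K₂ _ _ _ Φ₂ ι₂ θ₂ hA₀ hA₁ hA₂ hF hi
    obtain ⟨K₀', _, _, _, Φ₀', ι₀', θ₀', K₁', _, _, _, Φ₁', ι₁', θ₁', K₂', _, _, _, Φ₂', ι₂', θ₂', hA₀', hA₁', hA₂', hQ⟩ :=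
      hT3 B₀ B₁ B₂ hs₀ hs₁ hs₂ hd₀ hd₁ hd₂ h3₀ h3₁ h3₂ hn₀₁ hn₀₂ hn₁₂
    obtain ⟨ε₀, -⟩ := exists_ringEquiv_forall_mem_iff_of_isIsogenous hA₀ hA₀' hs₀ (IsIsogenous.refl _)
    obtain ⟨ε₁, -⟩ := exists_ringEquiv_forall_mem_iff_of_isIsogenous hA₁ hA₁' hs₁ (IsIsogenous.refl _)
    obtain ⟨ε₂, -⟩ := exists_ringEquiv_forall_mem_iff_of_isIsogenous hA₂ hA₂' hs₂ (IsIsogenous.refl _)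
    obtain ⟨⟨e₁⟩, ⟨e₂⟩⟩ := hi
    have hF' : ∃ F : IntermediateField ℚ K₀', Module.finrank ℚ F = 2 ∧ IsTotallyComplex F := by
      obtain ⟨F, hF2, hFtc⟩ := hF
      haveI := hFtc
      obtain ⟨F', hF'2, hF'tc, -⟩ := exists_quadratic_subfield_of_ringEquiv ε₀ ε₀ ⟨F, hF2, hFtc, ⟨algebraMap F K₀⟩⟩
      exact ⟨F', hF'2, hF'tc⟩
    exact hQ hF' ⟨⟨ε₁.symm.trans (e₁.trans ε₀)⟩, ⟨ε₂.symm.trans (e₂.trans ε₀)⟩⟩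
  · intro B₀ B₁ B₂ hs₀ hs₁ hs₂ hd₀ hd₁ hd₂ h3₀ h3₁ h3₂ hn₀₁ hn₂₀ hn₂₁ K₀ _ _ _ Φ₀ ι₀ θ₀ K₁ _ _ _ Φ₁ ι₁ θ₁ K₂ _ _ _ Φ₂ ι₂ θ₂ hA₀ hA₁ hA₂ hF hi₁ he₂
    obtain ⟨K₀', _, _, _, Φ₀', ι₀', θ₀', K₁', _, _, _, Φ₁', ι₁', θ₁', K₂', _, _, _, Φ₂', ι₂', θ₂', hA₀', hA₁', hA₂', hQ⟩ :=
      hT4 B₀ B₁ B₂ hs₀ hs₁ hs₂ hd₀ hd₁ hd₂ h3₀ h3₁ h3₂ hn₀₁ hn₂₀ hn₂₁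
    obtain ⟨ε₀, -⟩ := exists_ringEquiv_forall_mem_iff_of_isIsogenous hA₀ hA₀' hs₀ (IsIsogenous.refl _)
    obtain ⟨ε₁, -⟩ := exists_ringEquiv_forall_mem_iff_of_isIsogenous hA₁ hA₁' hs₁ (IsIsogenous.refl _)
    obtain ⟨ε₂, -⟩ := exists_ringEquiv_forall_mem_iff_of_isIsogenous hA₂ hA₂' hs₂ (IsIsogenous.refl _)
    obtain ⟨e₁⟩ := hi₁
    have hF' : ∃ F : IntermediateField ℚ K₀', Module.finrank ℚ F = 2 ∧ IsTotallyComplex F := by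
      obtain ⟨F, hF2, hFtc⟩ := hF
      haveI := hFtc
      obtain ⟨F', hF'2, hF'tc, -⟩ := exists_quadratic_subfield_of_ringEquiv ε₀ ε₀ ⟨F, hF2, hFtc, ⟨algebraMap F K₀⟩⟩
      exact ⟨F', hF'2, hF'tc⟩
    have he₂' : IsEmpty (K₂' ≃+* K₀') := ⟨fun e => he₂.false (ε₂.trans (e.trans ε₀.symm))⟩
    have h := hQ hF' ⟨ε₁.symm.trans (e₁.trans ε₀)⟩ he₂'
    rw [← normalClosure_eq_of_ringEquiv ε₂, ← normalClosure_eq_of_ringEquiv ε₀] at h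
    exact h

end OnTheVariety

end Summit.HodgeConjecture.CorCM.MultiFieldWeil

end
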